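import Mathlib.Tactic.Linarith
import Summits.CriticalPhenomena.PercolationContinuityZ3.Theorems.PercNearOneGluingNoHeavyLowerTailSahiCTCLevelDuality
import Summits.CriticalPhenomena.PercolationContinuityZ3.Theorems.PercNearOneGluingNoHeavyLowerTailSahiCTCCoLevelTwoSingle
import HarnessLib

/-!
# `NoHeavyLowerTail` (crux stmt-CriticalPhenomena-4575), P3 lane: the (TC) row of the slot "at least two of k open" for the SOLVED SUB-CASES —
# `Ñ_{k−2}(K_𝒳,K_𝒵) ∈ ℕ[r]` (hence `≥ 0` at every interior odds vector) whenever the all-live parts of the open families are nested or share exactly one 2-set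

Support file (seat `prim-l12-p3`, gen 24; `--supports stmt-CriticalPhenomena-4575`).  Memo `run/shared/lean/prim/prim-l12/FROM-prim-l12-p3-g24-VALUE-
LEVEL-TH2K.md` §−1.  End-to-end composition of the gen-24 chain: `Mop 2 (openFam 𝒳) (openFam 𝒵)` (`…SahiCTCLevelDuality`) is literally the polynomial
`M₂` of `…SahiCTCCoLevelTwoSplit` (by `unfold`), so `coeff_Mtwo_nonneg_of_subset` / `coeff_Mtwo_nonneg_of_singleEdge` feed `coeff_Ngen_cx_nonneg_of_Mop
(t := 2)` and `ev_Ngen_cx_nonneg_of_Mop`.  The hypothesis `hN` of `…SahiAtLeastTwoRowA.sahiE_three_nonneg_of_atLeastTwo_of_Ngen` asks this for ALL pairs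
of up-sets; here it is discharged for the pairs whose open families have nested all-live parts, or all-live parts with a single common 2-set.
* `coeff_Ngen_cx_nonneg_of_nestedLive`, `ev_Ngen_cx_nonneg_of_nestedLive`; `coeff_Ngen_cx_nonneg_of_singleEdge`, `ev_Ngen_cx_nonneg_of_singleEdge`.
Nothing is asserted about the crux in general.
-/

noncomputable section

open scoped Classical

namespace Summit.CriticalPhenomena.PercolationContinuityZ3.Theorems

namespace SahiAllButC

open Finset MvPolynomial
open SahiHittingSlot SahiTransportCert SahiAllButOne SahiAllButTwo SahiCTCForms SahiCTCGenFun SahiCTCWeightedLYM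

variable {k : ℕ}

/-- **Nested all-live parts ⇒ `Ñ_{k−2}(K_𝒳,K_𝒵) ∈ ℕ[r]`** (`2 ≤ k`; `𝒳, 𝒵` up-sets of the pattern cube whose open sets of size `≥ 2` are nested). [this work] -/
theorem coeff_Ngen_cx_nonneg_of_nestedLive (hk : 2 ≤ k) {𝒳 𝒵 : Set (Set (Fin k))} (h𝒳 : IsUpperSet 𝒳) (h𝒵 : IsUpperSet 𝒵)
    (hsub : ((openFam 𝒳).filter fun S => 2 ≤ #S) ⊆ ((openFam 𝒵).filter fun S => 2 ≤ #S)) :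
    ∀ m, 0 ≤ (Ngen (k - 2) (cx 𝒳) (cx 𝒵)).coeff m := by
  refine coeff_Ngen_cx_nonneg_of_Mop hk fun n => ?_
  unfold Mop atLeast below exact
  exact coeff_Mtwo_nonneg_of_subset (isUpperSet_openFam h𝒳) (isUpperSet_openFam h𝒵) hsub n

/-- The same at the odds vector of any interior parameter vector. [this work] -/
theorem ev_Ngen_cx_nonneg_of_nestedLive (hk : 2 ≤ k) {q : Fin k → unitInterval} (hq : ∀ i, 0 < (q i : ℝ) ∧ (q i : ℝ) < 1)
    {𝒳 𝒵 : Set (Set (Fin k))} (h𝒳 : IsUpperSet 𝒳) (h𝒵 : IsUpperSet 𝒵)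
    (hsub : ((openFam 𝒳).filter fun S => 2 ≤ #S) ⊆ ((openFam 𝒵).filter fun S => 2 ≤ #S)) :
    0 ≤ ev q (Ngen (k - 2) (cx 𝒳) (cx 𝒵)) := by
  refine ev_Ngen_cx_nonneg_of_Mop hk hq fun n => ?_
  unfold Mop atLeast below exact
  exact coeff_Mtwo_nonneg_of_subset (isUpperSet_openFam h𝒳) (isUpperSet_openFam h𝒵) hsub n

/-- **A single common open 2-set ⇒ `Ñ_{k−2}(K_𝒳,K_𝒵) ∈ ℕ[r]`** (`𝒳, 𝒵` up-sets whose common open sets of size `2` are exactly `{u,v}`). [this work] -/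
theorem coeff_Ngen_cx_nonneg_of_singleEdge (hk : 2 ≤ k) {𝒳 𝒵 : Set (Set (Fin k))} (h𝒳 : IsUpperSet 𝒳) (h𝒵 : IsUpperSet 𝒵)
    {u v : Fin k} (huv : u ≠ v) (he𝒳 : ({u, v} : Finset (Fin k)) ∈ openFam 𝒳) (he𝒵 : ({u, v} : Finset (Fin k)) ∈ openFam 𝒵)
    (hW : ((openFam 𝒳 ∩ openFam 𝒵).filter fun S => #S = 2) = {{u, v}}) :
    ∀ m, 0 ≤ (Ngen (k - 2) (cx 𝒳) (cx 𝒵)).coeff m := by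
  refine coeff_Ngen_cx_nonneg_of_Mop hk fun n => ?_
  unfold Mop atLeast below exact
  exact coeff_Mtwo_nonneg_of_singleEdge (isUpperSet_openFam h𝒳) (isUpperSet_openFam h𝒵) huv he𝒳 he𝒵 hW n

/-- The same at the odds vector of any interior parameter vector. [this work] -/
theorem ev_Ngen_cx_nonneg_of_singleEdge (hk : 2 ≤ k) {q : Fin k → unitInterval} (hq : ∀ i, 0 < (q i : ℝ) ∧ (q i : ℝ) < 1)
    {𝒳 𝒵 : Set (Set (Fin k))} (h𝒳 : IsUpperSet 𝒳) (h𝒵 : IsUpperSet 𝒵)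
    {u v : Fin k} (huv : u ≠ v) (he𝒳 : ({u, v} : Finset (Fin k)) ∈ openFam 𝒳) (he𝒵 : ({u, v} : Finset (Fin k)) ∈ openFam 𝒵)
    (hW : ((openFam 𝒳 ∩ openFam 𝒵).filter fun S => #S = 2) = {{u, v}}) :
    0 ≤ ev q (Ngen (k - 2) (cx 𝒳) (cx 𝒵)) := by
  refine ev_Ngen_cx_nonneg_of_Mop hk hq fun n => ?_
  unfold Mop atLeast below exact
  exact coeff_Mtwo_nonneg_of_singleEdge (isUpperSet_openFam h𝒳) (isUpperSet_openFam h𝒵) huv he𝒳 he𝒵 hW n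

end SahiAllButC

end Summit.CriticalPhenomena.PercolationContinuityZ3.Theorems
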